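import Literature.AlgebraicGeometry.HodgeTheory.SparseFermatFamily
import Literature.AlgebraicGeometry.HodgeTheory.DiagonalSymmetryGysinEquivariance
import Literature.AlgebraicGeometry.HodgeTheory.CanonicalTrace
import Literature.AlgebraicTopology.SingularHomology.PoincareDualityCorollaries
import HarnessLib

/-!
# Equivariant Poincaré duality for diagonal symmetries: the cup product is perfect on the invariant
# middle cohomology (stub `stub_invariantCupPerfect` of crux `InvariantClassesAreHodge`)

Crux `Summit.HodgeConjecture.HodgeConjecture.Theses.SparseFermatTropicalDeficiency.InvariantClassesAreHodge`
(item `stmt-HodgeConjecture-18620`, route `SparseFermatTropicalDeficiency`, line `birth`), registered stub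
`stub_invariantCupPerfect` with signature `InvariantCupPerfect`:

  `∀ (𝔇 : SparseFermat.Datum) (c : ↥𝔇.B → ℂ), IsSmoothProjective (2 * 𝔇.p) (𝔇.variety c) →`
  `  Module.finrank ℂ ↥(LinearMap.range (𝔇.proj c)) ≤ cupRank (𝔇.variety c) (2 * 𝔇.p) (LinearMap.range (𝔇.proj c))`.

This file proves that body VERBATIM (`invariantCupPerfect`), so the lead closes the stub by
`exact Summit.HodgeConjecture.HodgeConjecture.Theorems.invariantCupPerfect`.  The proof is the
equivariant Poincaré duality argument of the line card, for an arbitrary finite group `G` of diagonal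
symmetries of a form `F` whose hypersurface `X_F` is smooth projective of dimension `k`
(`finrank_diagonalInvariants_eq_cupRank`):

* `map_diagonalMap_top_eq_self` — **`g_a^*` is the identity on the top cohomology `H²ᵏ(X_F(ℂ); ℂ)`**:
  `g_a` is an automorphism, hence birational, so `g_a(ℂ)_* [X_F(ℂ)] = [X_F(ℂ)]` for the complex
  orientation (`map_fundamentalClass_complexOrientationFamily_of_isBirational`, Fulton Lemma 19.1.2 with
  degree `1`), whence `∫ g_a^* x = ∫ x` and `g_a^* x = x` (`traceC` is injective, Hatcher Thm. 3.26);
* `cupProduct_eigenProjector_one` — **`w ⌣ π v = w ⌣ v` for `w` invariant**, `π = |G|⁻¹ Σ_a g_a^*` the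
  projector onto the invariants: `w ⌣ g_a^* v = g_a^* w ⌣ g_a^* v = g_a^*(w ⌣ v) = w ⌣ v`
  (multiplicativity of pull-back, Hatcher Prop. 3.10, and the previous point);
* `injective_cupProduct_domRestrict_diagonalInvariants` — **the cup product restricted to the
  invariants `V₁ = range π` has no left kernel**: if `w ∈ V₁` cups to zero with all of `V₁` then
  `w ⌣ v = w ⌣ π v = 0` for every `v`, so `⟨w ⌣ v, [X_F(ℂ)]⟩ = 0` for every `v` and `w = 0` by the
  nonsingularity of the cup pairing of the closed oriented manifold `X_F(ℂ)` over the field `ℂ`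
  (Hatcher Prop. 3.38, the tree's PROVED `isPerfPair_cupPairing_of_field_holds`);
* hence `cupRank X_F k V₁ = dim V₁` (`finrank_diagonalInvariants_eq_cupRank`), and the stub.

Everything is proved; no definitions, no named facts, no `sorry`.

## References

* [HatcherAT2002] A. Hatcher, Algebraic Topology, CUP 2002, §3.2 Prop. 3.10, §3.3 Thm. 3.26, Thm. 3.30,
  Prop. 3.38.
* [Fulton1998] W. Fulton, Intersection Theory, 2nd ed. 1998, Lemma 19.1.2.
* [Shioda1979HodgeFermat] T. Shioda, The Hodge conjecture for Fermat varieties, Math. Ann. 245 (1979),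
  §1.
-/

set_option linter.dupNamespace false

noncomputable section

open CategoryTheory AlgebraicGeometry
open Literature.AlgebraicTopology.SingularHomology
open Literature.AlgebraicGeometry.Motives Literature.AlgebraicGeometry.HodgeTheory

namespace Summit.HodgeConjecture.HodgeConjecture.Theorems

/-! ### §1 Diagonal symmetries act trivially on the top cohomology -/

section Diagonal

variable {n k : ℕ} (F : MvPolynomial (Fin (n + 2)) ℂ) {G : Subgroup (Fin (n + 2) → ℂˣ)} [Fintype G]
  {a : Fin (n + 2) → ℂˣ}

/-- **`g_a(ℂ)_* [X_F(ℂ)] = [X_F(ℂ)]`** for the complex orientation of the closed manifold `X_F(ℂ)`,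
`X_F` smooth projective of dimension `k` and `g_a` the automorphism of a diagonal symmetry `a` of `F`
(an automorphism is birational and birational morphisms have degree `+1` for the complex orientations).
[cite: Fulton1998, Lemma 19.1.2] -/
theorem map_diagonalMap_fundamentalClass (hX : IsSmoothProjective k (SmoothHypersurface.hypersurface F))
    (ha : a ∈ diagonalStabilizer F) :
    singularHomology.map ℂ ℂ (diagonalMap F ha) (2 * k) (complexOrientationFamily hX).fundamentalClass =
      (complexOrientationFamily hX).fundamentalClass :=
  map_fundamentalClass_complexOrientationFamily_of_isBirational hX hX (diagonalAut F ha)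
    (isBirational_diagonalAut_left F ha)

/-- **`∫ g_a^* x = ∫ x`** on `H²ᵏ(X_F(ℂ); ℂ)`: `⟨g_a^* x, [X]⟩ = ⟨x, g_{a*}[X]⟩ = ⟨x, [X]⟩`.
[cite: HatcherAT2002, §3.3 Thm. 3.26] -/
theorem traceC_map_diagonalMap (hX : IsSmoothProjective k (SmoothHypersurface.hypersurface F))
    (ha : a ∈ diagonalStabilizer F) (x : complexBetti (SmoothHypersurface.hypersurface F) (2 * k)) :
    traceC hX (singularCohomology.map ℂ ℂ (diagonalMap F ha) (2 * k) x) = traceC hX x := by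
  rw [traceC_apply, traceC_apply, kroneckerPairing_map, map_diagonalMap_fundamentalClass F hX ha]

/-- **A diagonal symmetry acts as the identity on the top cohomology** `H²ᵏ(X_F(ℂ); ℂ)` of a smooth
projective `k`-dimensional hypersurface `X_F` (the trace `H²ᵏ(X_F(ℂ); ℂ) → ℂ` is injective and
`g_a^*`-invariant). [cite: HatcherAT2002, §3.3 Thm. 3.26] [cite: Fulton1998, Lemma 19.1.2] -/
theorem map_diagonalMap_top_eq_self (hX : IsSmoothProjective k (SmoothHypersurface.hypersurface F))
    (ha : a ∈ diagonalStabilizer F) (x : complexBetti (SmoothHypersurface.hypersurface F) (2 * k)) :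
    singularCohomology.map ℂ ℂ (diagonalMap F ha) (2 * k) x = x :=
  traceC_injective hX (traceC_map_diagonalMap F hX ha x)

/-! ### §2 Cup product with an invariant class commutes with averaging -/

/-- Changing the degree bookkeeping of a cup product does not change whether it vanishes.
[cite: HatcherAT2002, §3.2 Prop. 3.10] -/
theorem cupProduct_eq_zero_iff_cupProduct_rfl_eq_zero {Y : Type} [TopologicalSpace Y] {p q m : ℕ}
    (h : p + q = m) (x : singularCohomology ℂ ℂ Y p) (y : singularCohomology ℂ ℂ Y q) :
    cupProduct h x y = 0 ↔ cupProduct (rfl : p + q = p + q) x y = 0 := by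
  subst h
  exact Iff.rfl

variable (hG : G ≤ diagonalStabilizer F)

omit [Fintype G] in
/-- **`w ⌣ g_a^* v = w ⌣ v` in the top degree for an invariant class `w`**: `w = g_a^* w`, pull-back
is multiplicative, and `g_a^*` is the identity on `H²ᵏ`. [cite: HatcherAT2002, §3.2 Prop. 3.10] -/
theorem cupProduct_map_diagonalMap_of_mem (hX : IsSmoothProjective k (SmoothHypersurface.hypersurface F))
    (h2 : k + k = 2 * k) {w : complexBetti (SmoothHypersurface.hypersurface F) k}
    (hw : w ∈ diagonalCharacterEigenspace F G 1 k) (a : G)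
    (v : complexBetti (SmoothHypersurface.hypersurface F) k) :
    cupProduct h2 w (singularCohomology.map ℂ ℂ (diagonalMap F (hG a.2)) k v) = cupProduct h2 w v := by
  have hwa : singularCohomology.map ℂ ℂ (diagonalMap F (hG a.2)) k w = w := by
    rw [(mem_diagonalCharacterEigenspace_iff_diagonalMap hG).mp hw a, MonoidHom.one_apply, Units.val_one,
      one_smul]
  conv_lhs => rw [← hwa]
  rw [← cupProduct_map, map_diagonalMap_top_eq_self F hX (hG a.2)]

/-- **`w ⌣ π v = w ⌣ v` for `w` invariant**, `π = |G|⁻¹ Σ_{a ∈ G} g_a^*` the projector onto the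
`G`-invariants (`eigenProjector` at the trivial character). [cite: Shioda1979HodgeFermat, §1]
[cite: HatcherAT2002, §3.2 Prop. 3.10] -/
theorem cupProduct_eigenProjector_one (hX : IsSmoothProjective k (SmoothHypersurface.hypersurface F))
    (h2 : k + k = 2 * k) {w : complexBetti (SmoothHypersurface.hypersurface F) k}
    (hw : w ∈ diagonalCharacterEigenspace F G 1 k) (v : complexBetti (SmoothHypersurface.hypersurface F) k) :
    cupProduct h2 w (eigenProjector F (1 : G →* ℂˣ) k hG v) = cupProduct h2 w v := by
  rw [eigenProjector_apply, map_smul, map_sum]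
  have hterm : ∀ a : G, cupProduct h2 w ((((1 : G →* ℂˣ) a : ℂˣ) : ℂ)⁻¹ •
      singularCohomology.map ℂ ℂ (diagonalMap F (hG a.2)) k v) = cupProduct h2 w v := fun a ↦ by
    rw [MonoidHom.one_apply, Units.val_one, inv_one, one_smul,
      cupProduct_map_diagonalMap_of_mem F hG hX h2 hw a v]
  simp_rw [hterm]
  rw [Finset.sum_const, Finset.card_univ, ← Nat.cast_smul_eq_nsmul ℂ, smul_smul,
    inv_mul_cancel₀ (Nat.cast_ne_zero.mpr Fintype.card_ne_zero : (Fintype.card G : ℂ) ≠ 0), one_smul]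

/-! ### §3 The cup product restricted to the invariants has trivial left kernel -/

/-- **Equivariant Poincaré duality, kernel form.** For `X_F` smooth projective of dimension `k` and a
finite group `G` of diagonal symmetries of `F`, an invariant class `w ∈ V₁ = range π ⊆ Hᵏ(X_F(ℂ); ℂ)`
with `w ⌣ w' = 0` for all invariant `w'` is zero: `w ⌣ v = w ⌣ π v = 0` for every `v`, so
`⟨w ⌣ v, [X_F(ℂ)]⟩ = 0` for every `v`, and the cup pairing of the closed `ℂ`-oriented `2k`-manifold
`X_F(ℂ)` is perfect (Hatcher Prop. 3.38). [cite: HatcherAT2002, §3.3 Prop. 3.38]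
[cite: Shioda1979HodgeFermat, §1] -/
theorem eq_zero_of_forall_cupProduct_invariant_eq_zero
    (hX : IsSmoothProjective k (SmoothHypersurface.hypersurface F))
    {w : complexBetti (SmoothHypersurface.hypersurface F) k}
    (hw : w ∈ LinearMap.range (eigenProjector F (1 : G →* ℂˣ) k hG))
    (h0 : ∀ w' ∈ LinearMap.range (eigenProjector F (1 : G →* ℂˣ) k hG),
      cupProduct (rfl : k + k = k + k) w w' = 0) :
    w = 0 := by
  have h2 : k + k = 2 * k := (two_mul k).symm
  have hw' : w ∈ diagonalCharacterEigenspace F G 1 k := by rwa [range_eigenProjector] at hw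
  -- `w ⌣ v = 0` for EVERY `v`
  have hall : ∀ v : complexBetti (SmoothHypersurface.hypersurface F) k, cupProduct h2 w v = 0 := fun v ↦ by
    rw [← cupProduct_eigenProjector_one F hG hX h2 hw' v, cupProduct_eq_zero_iff_cupProduct_rfl_eq_zero]
    exact h0 _ (LinearMap.mem_range_self _ v)
  -- nonsingularity of the cup pairing of the closed oriented manifold `X_F(ℂ)` over the field `ℂ`
  letI := hX.chartedSpace
  haveI := ComplexPoints.compactSpace_of_isSmoothProjective hX
  haveI := ComplexPoints.t2Space_of_isSmoothProjective hX
  haveI hP : (cupPairing (complexOrientationFamily hX) h2).IsPerfPair := isPerfPair_cupPairing_of_field_holds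
  have hzero : cupPairing (complexOrientationFamily hX) h2 w = 0 := by
    refine LinearMap.ext fun v ↦ ?_
    rw [cupPairing_apply, hall v, map_zero, LinearMap.zero_apply, LinearMap.zero_apply]
  exact (injective_iff_map_eq_zero _).1
    (LinearMap.IsPerfPair.bijective_left (cupPairing (complexOrientationFamily hX) h2)).1 w hzero

/-- **The cup product `V₁ × V₁ → H²ᵏ(X_F(ℂ); ℂ)` on the invariants has injective adjoint**
`w ↦ (w ⌣ ·)|_{V₁}`. [cite: HatcherAT2002, §3.3 Prop. 3.38] [cite: Shioda1979HodgeFermat, §1] -/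
theorem injective_cupProduct_domRestrict_diagonalInvariants
    (hX : IsSmoothProjective k (SmoothHypersurface.hypersurface F)) :
    Function.Injective ((cupProduct (R := ℂ) (X := ComplexPoints (SmoothHypersurface.hypersurface F))
      (rfl : k + k = k + k)).domRestrict₁₂ (LinearMap.range (eigenProjector F (1 : G →* ℂˣ) k hG))
        (LinearMap.range (eigenProjector F (1 : G →* ℂˣ) k hG))) := by
  refine (injective_iff_map_eq_zero _).2 fun w hw0 ↦ ?_
  refine Subtype.ext (eq_zero_of_forall_cupProduct_invariant_eq_zero F hG hX w.2 fun w' hw' ↦ ?_)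
  have h := LinearMap.congr_fun hw0 ⟨w', hw'⟩
  rwa [LinearMap.domRestrict₁₂_apply, LinearMap.zero_apply] at h

/-- **Equivariant Poincaré duality, rank form**: the rank of the cup product restricted to the
`G`-invariants `V₁ = range π ⊆ Hᵏ(X_F(ℂ); ℂ)` of a smooth projective `k`-dimensional hypersurface
equals `dim V₁`. [cite: HatcherAT2002, §3.3 Prop. 3.38] [cite: Shioda1979HodgeFermat, §1] -/
theorem finrank_diagonalInvariants_eq_cupRank (hX : IsSmoothProjective k (SmoothHypersurface.hypersurface F)) :
    Module.finrank ℂ ↥(LinearMap.range (eigenProjector F (1 : G →* ℂˣ) k hG)) =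
      cupRank (SmoothHypersurface.hypersurface F) k (LinearMap.range (eigenProjector F (1 : G →* ℂˣ) k hG)) :=
  (LinearMap.finrank_range_of_inj (injective_cupProduct_domRestrict_diagonalInvariants F hG hX)).symm

end Diagonal

/-! ### §4 The registered stub -/

/-- **Stub `stub_invariantCupPerfect` of crux `InvariantClassesAreHodge` (body of `InvariantCupPerfect`
verbatim)**: for every sparse Fermat datum `𝔇` and every `c` with `X_c` smooth projective of dimension
`2p`, the cup product restricted to the `A_B`-invariants `range (𝔇.proj c) ⊆ H^{2p}(X_c(ℂ); ℂ)` has rank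
at least `dim range (𝔇.proj c)` (indeed equal to it, `finrank_diagonalInvariants_eq_cupRank`).
[cite: HatcherAT2002, §3.3 Thm. 3.30 and Prop. 3.38] [cite: Shioda1979HodgeFermat, §1] -/
theorem invariantCupPerfect :
    ∀ (𝔇 : SparseFermat.Datum) (c : ↥𝔇.B → ℂ),
      IsSmoothProjective (2 * 𝔇.p) (𝔇.variety c) →
      Module.finrank ℂ ↥(LinearMap.range (𝔇.proj c)) ≤
        cupRank (𝔇.variety c) (2 * 𝔇.p) (LinearMap.range (𝔇.proj c)) :=
  fun 𝔇 c hX ↦ (finrank_diagonalInvariants_eq_cupRank (𝔇.form c) (𝔇.group_le_diagonalStabilizer c) hX).le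

end Summit.HodgeConjecture.HodgeConjecture.Theorems

end
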